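import Mathlib
import Summits.ValiantsHypothesis.ValiantsHypothesis.Theorems.MonotoneRestorationOrbitRestorationQPRowColumnLowerBound
import Literature.Computability.AlgebraicComplexity.AlperBogartVelascoProofs
import HarnessLib

/-!
# Calibration at the permanent: every depth-three representation of `per_n` has `≥ (n−1)²` distinct affine factors (ORBIT currency)

Route MonotoneRestoration, crux `OrbitRestorationQP` (stmt-ValiantsHypothesis-18293), line `depth-three-rung`, registered stub
`stub_sigmaPiSigmaValue` (A_∞).  Namespace `Summit.ValiantsHypothesis.ValiantsHypothesis.Theorems.RowColumnPermanent`.  Definition-free.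

The derivative test of `Theorems/…RowColumnLowerBound.lean` applied to the route's target polynomial: the double-difference
derivation `∂_{00} − ∂_{10} − ∂_{01} + ∂_{11}` of the generic permanent, evaluated at the identity matrix, is
`per(I^{00}) − per(I^{10}) − per(I^{01}) + per(I^{11}) = 1 − 0 − 0 + 1 = 2 ≠ 0` (`I^{rc}` = the identity with row `r` and column `c`
deleted; von zur Gathen's `∂ per / ∂x_rc = per(x^{rc})`, tree `AlperBogartVelasco.eval_pderiv_perPoly_eq_permanent_submatrix`).  Hence:

* `permanent_eq_zero_of_row_eq_zero` — a matrix with a zero row has permanent `0` (Mathlib lacks it);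
* `eval_ddiffDeriv_perPoly` — the evaluation above equals `2`;
* `perPoly_not_mem_adjoin_rowcol` — **`per_n ∉ ℂ[r, c]`** for `n ≥ 2`: the permanent lies on the far side of the essential-variable
  dichotomy;
* `sq_le_card_distinct_factors_perPoly` — **every depth-three representation `per_n = Σ_i C(a i) · Π (L i)` with affine factors uses
  at least `(n−1)²` DISTINCT factors** (any number of terms, any fan-in).

Calibration: a weak unconditional `ΣΠΣ` statement for the permanent over `ℂ` (print knows near-cubic `ΣΠΣ` lower bounds for explicit
polynomials, Kayal–Saha–Tavenas 2016; this one counts distinct affine forms only), recorded to place `per` with respect to the new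
stratum of A_∞.  Nothing here bears on VP ≠ VNP. [folklore]

## References
* J. von zur Gathen, *Permanent and determinant*, LAA 96 (1987), §2. [Vonzurgathen1987]
* A. Dawar, G. Wilsenach, *Symmetric arithmetic circuits*, ToC 21 (2025), §3.3, Thm 7.1. [DawarWilsenach2025]
-/

noncomputable section

open scoped Classical

-- `Summit.ValiantsHypothesis.ValiantsHypothesis.…` is the tree's single-conjunct layout (Sub = Summit).
set_option linter.dupNamespace false

namespace Summit.ValiantsHypothesis.ValiantsHypothesis.Theorems

namespace RowColumnPermanent

open MvPolynomial Equiv Literature.Computability.AlgebraicComplexity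

/-! ### A zero row kills the permanent -/

/-- A matrix with a zero row has permanent `0`. [folklore] -/
theorem permanent_eq_zero_of_row_eq_zero {ι R : Type*} [Fintype ι] [DecidableEq ι] [CommSemiring R] (M : Matrix ι ι R)
    (i₀ : ι) (h : ∀ j, M i₀ j = 0) : M.permanent = 0 := by
  unfold Matrix.permanent
  refine Finset.sum_eq_zero fun σ _ => ?_
  exact Finset.prod_eq_zero (Finset.mem_univ (σ⁻¹ i₀)) (by rw [Perm.coe_inv, Equiv.apply_symm_apply]; exact h _)

/-! ### The double-difference derivative of the permanent at the identity -/

/-- The evaluation point: the identity matrix. [folklore] -/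
theorem of_ite_eq_one (m : ℕ) :
    (Matrix.of fun i j : Fin (m + 2) => (fun q : Fin (m + 2) × Fin (m + 2) => if q.1 = q.2 then (1 : ℂ) else 0) (i, j)) =
      (1 : Matrix (Fin (m + 2)) (Fin (m + 2)) ℂ) := by
  ext i j
  simp [Matrix.one_apply]

/-- `per(I^{rc})`: `1` on the diagonal, `0` off it. [folklore] -/
theorem permanent_one_submatrix_succAbove (m : ℕ) (r c : Fin (m + 2)) :
    ((1 : Matrix (Fin (m + 2)) (Fin (m + 2)) ℂ).submatrix r.succAbove c.succAbove).permanent = if r = c then 1 else 0 := by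
  by_cases hrc : r = c
  · rw [if_pos hrc, hrc, Matrix.submatrix_one _ Fin.succAbove_right_injective, Matrix.permanent_one]
  · rw [if_neg hrc]
    obtain ⟨z, hz⟩ := Fin.exists_succAbove_eq (Ne.symm hrc)
    refine permanent_eq_zero_of_row_eq_zero _ z fun j => ?_
    rw [Matrix.submatrix_apply, hz, Matrix.one_apply, if_neg (Fin.succAbove_ne c j).symm]

/-- **`(∂_{00} − ∂_{10} − ∂_{01} + ∂_{11}) per`, evaluated at the identity, equals `2`.** [folklore] -/
theorem eval_ddiffDeriv_perPoly (m : ℕ) :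
    MvPolynomial.eval (fun q : Fin (m + 2) × Fin (m + 2) => if q.1 = q.2 then (1 : ℂ) else 0)
      (pderiv ((0 : Fin (m + 2)), (0 : Fin (m + 2))) (perPoly (Fin (m + 2)) ℂ) -
        pderiv ((1 : Fin (m + 2)), (0 : Fin (m + 2))) (perPoly (Fin (m + 2)) ℂ) -
        pderiv ((0 : Fin (m + 2)), (1 : Fin (m + 2))) (perPoly (Fin (m + 2)) ℂ) +
        pderiv ((1 : Fin (m + 2)), (1 : Fin (m + 2))) (perPoly (Fin (m + 2)) ℂ)) = 2 := by
  have h01 : (0 : Fin (m + 2)) ≠ 1 := by simp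
  rw [map_add, map_sub, map_sub]
  rw [AlperBogartVelasco.eval_pderiv_perPoly_eq_permanent_submatrix, AlperBogartVelasco.eval_pderiv_perPoly_eq_permanent_submatrix,
    AlperBogartVelasco.eval_pderiv_perPoly_eq_permanent_submatrix, AlperBogartVelasco.eval_pderiv_perPoly_eq_permanent_submatrix,
    of_ite_eq_one, permanent_one_submatrix_succAbove, permanent_one_submatrix_succAbove, permanent_one_submatrix_succAbove,
    permanent_one_submatrix_succAbove, if_pos rfl, if_neg h01.symm, if_neg h01, if_pos rfl]
  norm_num

/-- The double-difference derivative of the permanent is nonzero (`n ≥ 2`). [folklore] -/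
theorem ddiffDeriv_perPoly_ne_zero (m : ℕ) :
    pderiv ((0 : Fin (m + 2)), (0 : Fin (m + 2))) (perPoly (Fin (m + 2)) ℂ) -
        pderiv ((1 : Fin (m + 2)), (0 : Fin (m + 2))) (perPoly (Fin (m + 2)) ℂ) -
        pderiv ((0 : Fin (m + 2)), (1 : Fin (m + 2))) (perPoly (Fin (m + 2)) ℂ) +
        pderiv ((1 : Fin (m + 2)), (1 : Fin (m + 2))) (perPoly (Fin (m + 2)) ℂ) ≠ 0 := by
  intro h
  have h2 := eval_ddiffDeriv_perPoly m
  rw [h, map_zero] at h2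
  norm_num at h2

/-! ### The permanent is on the far side of the dichotomy -/

/-- **`per_n ∉ ℂ[r, c]`** (`n ≥ 2`): the permanent is not a polynomial in the row sums and the column sums. [folklore] -/
theorem perPoly_not_mem_adjoin_rowcol (m : ℕ) :
    perPoly (Fin (m + 2)) ℂ ∉ Algebra.adjoin ℂ
      (Set.range (fun i : Fin (m + 2) => ∑ j : Fin (m + 2), (X (i, j) : MvPolynomial (Fin (m + 2) × Fin (m + 2)) ℂ)) ∪
        Set.range (fun j : Fin (m + 2) => ∑ i : Fin (m + 2), (X (i, j) : MvPolynomial (Fin (m + 2) × Fin (m + 2)) ℂ))) :=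
  fun h => ddiffDeriv_perPoly_ne_zero m (RowColumnLowerBound.ddiffDeriv_eq_zero_of_mem_adjoin_rowcol h 0 1 0 1)

/-- **Every depth-three representation of `per_n` uses at least `(n−1)²` distinct affine factors** (`n ≥ 2`; any number of terms,
any fan-in). [folklore] -/
theorem sq_le_card_distinct_factors_perPoly (m : ℕ) {k : ℕ} (a : Fin k → ℂ)
    (L : Fin k → Multiset (MvPolynomial (Fin (m + 2) × Fin (m + 2)) ℂ)) (hL : ∀ i, ∀ ℓ ∈ L i, ℓ.totalDegree ≤ 1)
    (hp : perPoly (Fin (m + 2)) ℂ = ∑ i, C (a i) * (L i).prod) :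
    (m + 1) ^ 2 ≤ (Finset.univ.biUnion fun i => (L i).toFinset).card := by
  -- the permanent is matrix-symmetric (permute rows and columns of the generic matrix)
  have hsym : ∀ σ τ : Perm (Fin (m + 2)),
      rename (fun q : Fin (m + 2) × Fin (m + 2) => (σ q.1, τ q.2)) (perPoly (Fin (m + 2)) ℂ) = perPoly (Fin (m + 2)) ℂ := by
    intro σ τ
    have h1 : rename (fun q : Fin (m + 2) × Fin (m + 2) => (σ q.1, τ q.2)) (perPoly (Fin (m + 2)) ℂ) =
        ((Matrix.mvPolynomialX (Fin (m + 2)) (Fin (m + 2)) ℂ).submatrix σ τ).permanent := by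
      simp only [perPoly, Matrix.permanent, map_sum, map_prod, Matrix.mvPolynomialX_apply, rename_X, Matrix.submatrix_apply]
    rw [h1, show ((Matrix.mvPolynomialX (Fin (m + 2)) (Fin (m + 2)) ℂ).submatrix σ τ) =
      (((Matrix.mvPolynomialX (Fin (m + 2)) (Fin (m + 2)) ℂ).submatrix id τ).submatrix σ id) from rfl,
      Matrix.permanent_permute_cols, Matrix.permanent_permute_rows]
    rfl
  have h := RowColumnLowerBound.sq_le_card_distinct_factors hsym (ddiffDeriv_perPoly_ne_zero m) a L hL hp
  simpa using h

end RowColumnPermanent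

end Summit.ValiantsHypothesis.ValiantsHypothesis.Theorems

end
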